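import Literature.IUT.HodgeArakelov.AbsTopMonoidsGenuineProducer
import Literature.IUT.HodgeArakelov.GaloisPairRigidity
import Literature.IUT.HodgeArakelov.KummerStructures
import Literature.AnabelianGeometry.AbsoluteAnabelian.GaloisPadicLogPowers
import Literature.AnabelianGeometry.AbsoluteAnabelian.MLFGaloisUnitsFunctors
import Literature.AnabelianGeometry.EtaleTheta.ZHatPadicCharacter
import HarnessLib

/-!
# [IUTchII] Example 1.8 (iv): the GENUINE isometry group `Ism(G)` and `Ẑ^× ↠ ℤ_p^× ↪ Ism(G)` at the model
# (MERGE-MAP row B9 (d), second half)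

S. Mochizuki, *Inter-universal Teichmüller theory II*, §1, Example 1.8 (iv), kurims manuscript (Dec. 2020) p. 39
[claim: Mochizuki2012, status: disputed] (IUTchII §1 Ex 1.8 (iv), kurims p.39): "let us write `Ism(G)` for the
compact topological group of `G`-isometries of `O^{×μ}(G)`, i.e., `G`-equivariant automorphisms of the
ind-topological module `O^{×μ}(G)` that, for each open subgroup `H ⊆ G`, preserve the lattice in `O^{×μ}(G)^H`
determined by the image of `O^×(G)^H` … another example of such a `Γ^{×μ}` is the image `Im(Ẑ^×)` of the natural
homomorphism `Ẑ^× ↠ ℤ_p^× ↪ Ism`."  abc-iut cell, layer L6, MERGE-MAP §8 row B9 (d) second half (abc-iut-L6-lead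
§F v1.19d (1) / v1.19k (1); v27 NN1 «residual = genuine `Ism`/`toIsm`»); seat abc-iut-L6-d2 (gen 5).

abc-iut-L6-t13's GENUINE-mod-`ε` producer `AbsTopMonoids.genuineOfModel S C ε hΔ hq` (p421397: `O^⊳(G) = 𝒪_k̄^⊳`
with THE lifted transports) leaves the `Ism` side DEGENERATE (`Ism := PUnit`, `actIsm`, `toIsm` trivial).  This
file REPLACES that side by the printed objects, keeping every other field definitionally unchanged:

* `AbsTopMonoids.openSubgroups G`, `AbsTopMonoids.ism A G := isometryGroup (A.actOunits G) (openSubgroups G)` —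
  **print's `Ism(G)` over ANY `A : AbsTopMonoids S`** (abc-iut-L6-t2's `isometryGroup` of `KummerStructures.lean`,
  Def. 4.9 (i) p. 154 = Ex. 1.8 (iv) p. 39, consumed BY NAME), and the generic re-packaging
  `AbsTopMonoids.withIsometries A z hz` (`Ism := ism`, `actIsm := inclusion`, `toIsm :=` the co-restriction of a
  given `Ẑ^×`-action `z` by isometries);
* at the model `C = (k, k̄)`: the bridge `Genuine.unitsBridge : (𝒪_k̄^⊳)ˣ ≃* 𝒪_k̄^×` / `oxmuBridge :
  O^{×μ} ≃* k~ = 𝒪_k̄^×⧸𝒪_k̄^μ`, the `Ẑ^×`-action `Genuine.zhatOxmu C : Ẑ^× →* Aut(O^{×μ})` = (A) the `p`-adic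
  cyclotomic character `Ẑ^× → ℤ_p^×` (`ZHatLevel.padicCharUnits`, `ZHatPadicCharacter.lean`) followed by (B) the
  `ℤ_p^×`-powers `x ↦ x^a` (`MLFClosure.zpPow`, `GaloisPadicLogPowers.lean`), and **the membership theorem
  `Genuine.zhatOxmu_mem_isometryGroup`**: every `u ∈ Ẑ^×` acts by a `G`-ISOMETRY — `G`-equivariance from
  `zpPow_unitsModTorsionGaloisMap`, lattice preservation for EVERY subgroup `H` (a fortiori every open one) from the
  lattice lemma `MLFClosure.exists_fixed_zpPow_mk_eq_mk`;
* **`AbsTopMonoids.genuineOfModelIsm S C ε hΔ hq : AbsTopMonoids S`** — ALL fields genuine (mod `ε` and the chosen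
  isomorphisms): `rfl` lemmas `genuineOfModelIsm_Otri / _actOtri / _mapOtri / _MTM` (so abc-iut-w4-d030's
  `GalRigidityInput` witnesses transfer verbatim), `genuineOfModelIsm_Ism` (`= isometryGroup …`),
  `toAdd_log_actIsm_toIsm` (`u` acts as `x ↦ x^{χ_p(u)}`: `log_k̄(u · x) = χ_p(u) · log_k̄ x`).
The proof-only sequel `AbsTopMonoidsGenuineIsometriesProofs.lean` shows that the action is NON-TRIVIAL (`−1 ∈ Ẑ^×`
acts by inversion: `actIsm_toIsm_negOneAut`, `actIsm_toIsm_ne_one`) and PROVES abc-iut-L6-t1's `Rmk1111_d`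
([IUTchII] Rmk. 1.11.1 (i) (d)) for this producer (`rmk1111_d_genuineOfModelIsm`); `ZHatPadicCharacterSurjective.lean`
shows `Ẑ^× ↠ ℤ_p^×` is onto (`ZHatLevel.padicCharUnits_surjective`).

HONEST FRAMING: record-only vocabulary under a disputed claim key; the constructions are classical ([AbsTopIII] +
`p`-adic analysis); nothing here bears on [IUTchIII] Cor. 3.12; `Rmk181_statement` (B9 (e), LCFT) is NOT claimed.
-/

set_option autoImplicit false

noncomputable section

namespace Literature.IUT.HodgeArakelov

open CategoryTheory
open Literature.AnabelianGeometry.AbsoluteAnabelian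
open Literature.AnabelianGeometry.EtaleTheta

namespace AbsTopMonoids

/-! ## Print's `Ism(G)` over the interface, and re-packaging an `AbsTopMonoids` with it -/

section Generic

universe u

variable {S : ThetaSetting.{u}}

/-- The family of OPEN subgroups of an isomorph `G` of `G_k` (the index set "for each open subgroup `H ⊆ G`" of
[IUTchII] Ex. 1.8 (iv)). [claim: Mochizuki2012, status: disputed] (IUTchII §1 Ex 1.8 (iv), kurims p.39) -/
def openSubgroups (G : IsoClass S.Gk) : Set (Subgroup G.G) := {H | IsOpen (H : Set G.G)}

/-- **`Ism(G)`** ([IUTchII] Ex. 1.8 (iv) p. 39): "the compact topological group of `G`-isometries of `O^{×μ}(G)`,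
i.e., `G`-equivariant automorphisms of … `O^{×μ}(G)` that, for each open subgroup `H ⊆ G`, preserve the lattice in
`O^{×μ}(G)^H` determined by the image of `O^×(G)^H`" — abc-iut-L6-t2's `isometryGroup` (Def. 4.9 (i)) for the
action `G ↷ O^×(G)` of `A` and the open subgroups of `G` (as an abstract group; topologies suppressed as everywhere
in the interface). [claim: Mochizuki2012, status: disputed] (IUTchII §1 Ex 1.8 (iv), kurims p.39) -/
abbrev ism (A : AbsTopMonoids S) (G : IsoClass S.Gk) : Subgroup (MulAut (A.Oxmu G)) :=
  isometryGroup (A.actOunits G) (openSubgroups G)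

/-- **Re-packaging**: replace the `Ism`-data of `A` by print's isometry group `Ism(G)` (`ism`), its tautological
action on `O^{×μ}(G)`, and the co-restriction `Ẑ^× → Ism(G)` of a given `Ẑ^×`-action `z` on `O^{×μ}(G)` by
`G`-isometries; all other fields unchanged. [claim: Mochizuki2012, status: disputed] (IUTchII §1 Ex 1.8 (iv), kurims p.39) -/
def withIsometries (A : AbsTopMonoids S) (z : ∀ G : IsoClass S.Gk, ZHatUnits →* MulAut (A.Oxmu G))
    (hz : ∀ (G : IsoClass S.Gk) (u : ZHatUnits), z G u ∈ A.ism G) : AbsTopMonoids S :=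
  { A with
    Ism := fun G => ↥(A.ism G)
    grpIsm := fun _ => inferInstance
    actIsm := fun G => (A.ism G).subtype
    toIsm := fun G => (z G).codRestrict (A.ism G) (hz G) }

variable (A : AbsTopMonoids S) (z : ∀ G : IsoClass S.Gk, ZHatUnits →* MulAut (A.Oxmu G))
  (hz : ∀ (G : IsoClass S.Gk) (u : ZHatUnits), z G u ∈ A.ism G)

/-- `O^⊳` is unchanged. [claim: Mochizuki2012, status: disputed] (IUTchII §1 Ex 1.8 (ii), kurims p.36) -/
@[simp] theorem withIsometries_Otri : (A.withIsometries z hz).Otri = A.Otri := rfl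

/-- The `G`-actions on `O^⊳(G)` are unchanged. [claim: Mochizuki2012, status: disputed] (IUTchII §1 Ex 1.8 (ii), kurims p.36) -/
@[simp] theorem withIsometries_actOtri : (A.withIsometries z hz).actOtri = A.actOtri := rfl

/-- The transports `O^⊳(f)` are unchanged. [claim: Mochizuki2012, status: disputed] (IUTchII §1 Ex 1.8 (iii), kurims p.38) -/
theorem withIsometries_mapOtri {G H : IsoClass S.Gk} (f : G ⟶ H) :
    (A.withIsometries z hz).mapOtri f = A.mapOtri f := rfl

/-- `M_TM` is unchanged. [claim: Mochizuki2012, status: disputed] (IUTchII §1 Ex 1.8 (ii), kurims p.36) -/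
@[simp] theorem withIsometries_MTM : (A.withIsometries z hz).MTM = A.MTM := rfl

/-- `Ism(G)` of the re-packaged data IS print's isometry group. [claim: Mochizuki2012, status: disputed] (IUTchII §1 Ex 1.8 (iv), kurims p.39) -/
theorem withIsometries_Ism (G : IsoClass S.Gk) : (A.withIsometries z hz).Ism G = ↥(A.ism G) := rfl

/-- `Ism(G)` acts on `O^{×μ}(G)` tautologically (by the underlying automorphism).
[claim: Mochizuki2012, status: disputed] (IUTchII §1 Ex 1.8 (iv), kurims p.39) -/
theorem withIsometries_actIsm_apply (G : IsoClass S.Gk) (φ : ↥(A.ism G)) (x : A.Oxmu G) :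
    (A.withIsometries z hz).actIsm G φ x = (φ : MulAut (A.Oxmu G)) x := rfl

/-- `Ẑ^× → Ism(G)` followed by the action is the given `Ẑ^×`-action `z`.
[claim: Mochizuki2012, status: disputed] (IUTchII §1 Ex 1.8 (iv), kurims p.39) -/
theorem withIsometries_actIsm_toIsm (G : IsoClass S.Gk) (u : ZHatUnits) :
    (A.withIsometries z hz).actIsm G ((A.withIsometries z hz).toIsm G u) = z G u := rfl

end Generic

/-! ## The model: `O^{×μ} = (𝒪_k̄^⊳)ˣ ⧸ μ ≅ k~ = 𝒪_k̄^× ⧸ 𝒪_k̄^μ` and the `Ẑ^×`-action -/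

namespace Genuine

variable (C : MLFClosure.{0})

/-- `𝒪_k̄^×` as the group `unitSubmonoid ≅ unitGroup` (two presentations of the same subset of `k̄`: abc-iut-L4-t2's
submonoid of `k̄`, this lineage's subgroup of `k̄^×`). [cite: MochizukiAbsTopIII2015, Definition 3.1 (i) p.66] -/
def unitSubmonoidEquivUnitGroup : unitSubmonoid C.k C.K ≃* unitGroup C.k C.K where
  toFun x := ⟨Units.mk0 (x : C.K) (ne_zero_of_mem_unitSubmonoid x.2), x.2⟩
  invFun u := ⟨((u : (C.K)ˣ) : C.K), u.2⟩
  left_inv _ := Subtype.ext rfl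
  right_inv _ := Subtype.ext (Units.ext rfl)
  map_mul' _ _ := Subtype.ext (Units.ext rfl)

/-- **`(𝒪_k̄^⊳)ˣ ≅ 𝒪_k̄^×`**: the units `O^×(G)` of the model monoid `O^⊳(G) = 𝒪_k̄^⊳`, as this lineage's `unitGroup`
(abc-iut-L4's `unitsEquivUnitSubmonoid` followed by `unitSubmonoidEquivUnitGroup`).
[cite: MochizukiAbsTopIII2015, Definition 3.1 (i) p.66] -/
def unitsBridge : (nonzeroIntegers C.k C.K)ˣ ≃* unitGroup C.k C.K :=
  (ModelMLFGaloisData.unitsEquivUnitSubmonoid C).trans (unitSubmonoidEquivUnitGroup C)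

/-- Underlying elements of `k̄` are preserved by the bridge. [cite: MochizukiAbsTopIII2015, Definition 3.1 (i) p.66] -/
@[simp] theorem coe_unitsBridge (x : (nonzeroIntegers C.k C.K)ˣ) :
    (((unitsBridge C x : unitGroup C.k C.K) : (C.K)ˣ) : C.K) = ((x : nonzeroIntegers C.k C.K) : C.K) := rfl

/-- … and by its inverse. [cite: MochizukiAbsTopIII2015, Definition 3.1 (i) p.66] -/
@[simp] theorem coe_unitsBridge_symm (v : unitGroup C.k C.K) :
    ((((unitsBridge C).symm v : (nonzeroIntegers C.k C.K)ˣ) : nonzeroIntegers C.k C.K) : C.K) = ((v : (C.K)ˣ) : C.K) := by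
  rw [← coe_unitsBridge C ((unitsBridge C).symm v), MulEquiv.apply_symm_apply]

/-- **`O^{×μ} = (𝒪_k̄^⊳)ˣ ⧸ μ ≅ k~ = 𝒪_k̄^× ⧸ 𝒪_k̄^μ`** (MERGE-MAP B9 (c): abc-iut-L6-t1's co-cyclotomic carrier vs this
lineage's perfection), the bridge `unitsBridge` modulo torsion. [claim: Mochizuki2012, status: disputed] (IUTchII §1 Ex 1.8 (iv), kurims p.38) -/
def oxmuBridge : ModTorsion (nonzeroIntegers C.k C.K)ˣ ≃* (unitGroup C.k C.K ⧸ CommGroup.torsion (unitGroup C.k C.K)) :=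
  MulEquivModTorsion (unitsBridge C)

/-- The bridge on classes. [claim: Mochizuki2012, status: disputed] (IUTchII §1 Ex 1.8 (iv), kurims p.38) -/
@[simp] theorem oxmuBridge_mk (x : (nonzeroIntegers C.k C.K)ˣ) :
    oxmuBridge C (QuotientGroup.mk x) = QuotientGroup.mk (unitsBridge C x) :=
  mulEquivModTorsion_mk _ x

/-- The inverse bridge on classes. [claim: Mochizuki2012, status: disputed] (IUTchII §1 Ex 1.8 (iv), kurims p.38) -/
theorem oxmuBridge_symm_mk (v : unitGroup C.k C.K) :
    (oxmuBridge C).symm (QuotientGroup.mk v) = QuotientGroup.mk ((unitsBridge C).symm v) := by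
  rw [MulEquiv.symm_apply_eq, oxmuBridge_mk, MulEquiv.apply_symm_apply]

/-! ### The `Ẑ^×`-action is by `G`-isometries, for EVERY Galois-type action -/

variable {Γ : Type} [Group Γ] (θ : Γ →* (C.K ≃ₐ[C.k] C.K))

/-- The action `Γ ↷ (𝒪_k̄^⊳)ˣ` induced by a homomorphism `θ : Γ → G_k` (for the producer: `θ` = the chosen
identification `Genuine.theta` of an isomorph `G` of `G_k`). [claim: Mochizuki2012, status: disputed] (IUTchII §1 Ex 1.8 (iii), kurims p.37) -/
def unitsActionOf : Γ →* MulAut (nonzeroIntegers C.k C.K)ˣ :=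
  (CoveringMonoid.unitsAct ⟨nonzeroIntegers C.k C.K,
    (MulDistribMulAction.toMulAut (ModelMLFGaloisData.galois C.k C.K).tmPair.Pi (nonzeroIntegers C.k C.K))⟩).comp θ

/-- On underlying elements of `k̄`, `γ` acts through the field automorphism `θ γ`.
[claim: Mochizuki2012, status: disputed] (IUTchII §1 Ex 1.8 (iii), kurims p.37) -/
@[simp] theorem coe_unitsActionOf (γ : Γ) (x : (nonzeroIntegers C.k C.K)ˣ) :
    (((unitsActionOf C θ γ x : (nonzeroIntegers C.k C.K)ˣ) : nonzeroIntegers C.k C.K) : C.K) =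
      θ γ ((x : nonzeroIntegers C.k C.K) : C.K) := rfl

/-- The bridge intertwines the `Γ`-action with the Galois action on `𝒪_k̄^×`.
[claim: Mochizuki2012, status: disputed] (IUTchII §1 Ex 1.8 (iii), kurims p.37) -/
theorem unitsBridge_unitsActionOf (γ : Γ) (x : (nonzeroIntegers C.k C.K)ˣ) :
    unitsBridge C (unitsActionOf C θ γ x) = unitGroupGaloisMap (θ γ) (unitsBridge C x) :=
  Subtype.ext (Units.ext rfl)

/-- … and, modulo torsion, with the Galois action on `k~`. [claim: Mochizuki2012, status: disputed] (IUTchII §1 Ex 1.8 (iv), kurims p.38) -/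
theorem oxmuBridge_actionModTorsion (γ : Γ) (x : ModTorsion (nonzeroIntegers C.k C.K)ˣ) :
    oxmuBridge C (actionModTorsion (unitsActionOf C θ) γ x) = unitsModTorsionGaloisMap (θ γ) (oxmuBridge C x) := by
  induction x using QuotientGroup.induction_on with
  | H y => rw [actionModTorsion_mk, oxmuBridge_mk, oxmuBridge_mk, unitsModTorsionGaloisMap_mk, unitsBridge_unitsActionOf]

variable [Fact C.residueChar.Prime]

/-! ### The `Ẑ^×`-action -/

/-- **The `Ẑ^×`-action on `O^{×μ} = (𝒪_k̄^⊳)ˣ⧸μ`** of [IUTchII] Ex. 1.8 (iv): `u ↦ (x ↦ x^{χ_p(u)})` — the `p`-adic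
cyclotomic character `Ẑ^× → ℤ_p^×` (`ZHatLevel.padicCharUnits`) followed by the `ℤ_p^×`-powers `MLFClosure.zpPow`,
transported along `oxmuBridge`. [claim: Mochizuki2012, status: disputed] (IUTchII §1 Ex 1.8 (iv), kurims p.39) -/
def zhatOxmu : ZHatUnits →* MulAut (ModTorsion (nonzeroIntegers C.k C.K)ˣ) :=
  (MulAut.congr (oxmuBridge C).symm).toMonoidHom.comp (C.zpPow.comp (ZHatLevel.padicCharUnits C.residueChar))

/-- Unfolding: `zhatOxmu C u x = oxmuBridge⁻¹ ((oxmuBridge x)^{χ_p(u)})`.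
[claim: Mochizuki2012, status: disputed] (IUTchII §1 Ex 1.8 (iv), kurims p.39) -/
theorem zhatOxmu_apply (u : ZHatUnits) (x : ModTorsion (nonzeroIntegers C.k C.K)ˣ) :
    zhatOxmu C u x = (oxmuBridge C).symm (C.zpPow (ZHatLevel.padicCharUnits C.residueChar u) (oxmuBridge C x)) :=
  rfl

/-- `oxmuBridge (zhatOxmu C u x) = (oxmuBridge x)^{χ_p(u)}`. [claim: Mochizuki2012, status: disputed] (IUTchII §1 Ex 1.8 (iv), kurims p.39) -/
@[simp] theorem oxmuBridge_zhatOxmu (u : ZHatUnits) (x : ModTorsion (nonzeroIntegers C.k C.K)ˣ) :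
    oxmuBridge C (zhatOxmu C u x) = C.zpPow (ZHatLevel.padicCharUnits C.residueChar u) (oxmuBridge C x) := by
  rw [zhatOxmu_apply, MulEquiv.apply_symm_apply]

/-- **`log_k̄ (u · x) = χ_p(u) · log_k̄ x`**: through `log_k̄`, `u ∈ Ẑ^×` acts on `O^{×μ}` as the scalar `χ_p(u)`.
[claim: Mochizuki2012, status: disputed] (IUTchII §1 Ex 1.8 (iv), kurims p.39) -/
theorem toAdd_log_zhatOxmu (u : ZHatUnits) (x : ModTorsion (nonzeroIntegers C.k C.K)ˣ) :
    Multiplicative.toAdd (C.logEquiv (oxmuBridge C (zhatOxmu C u x))) =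
      C.padicScalar (ZHatLevel.padicChar C.residueChar u) * Multiplicative.toAdd (C.logEquiv (oxmuBridge C x)) := by
  rw [oxmuBridge_zhatOxmu, MLFClosure.toAdd_logEquiv_zpPow]
  rfl

/-- **`G`-EQUIVARIANCE**: the `Ẑ^×`-action commutes with every Galois-type action on `O^{×μ}`.
[claim: Mochizuki2012, status: disputed] (IUTchII §1 Ex 1.8 (iv), kurims p.39) -/
theorem zhatOxmu_actionModTorsion (u : ZHatUnits) (γ : Γ) (x : ModTorsion (nonzeroIntegers C.k C.K)ˣ) :
    zhatOxmu C u (actionModTorsion (unitsActionOf C θ) γ x) =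
      actionModTorsion (unitsActionOf C θ) γ (zhatOxmu C u x) := by
  apply (oxmuBridge C).injective
  rw [oxmuBridge_zhatOxmu, oxmuBridge_actionModTorsion, oxmuBridge_actionModTorsion, oxmuBridge_zhatOxmu,
    MLFClosure.zpPow_unitsModTorsionGaloisMap]

/-- **LATTICE PRESERVATION (one inclusion)**: for every subgroup `H ⊆ Γ`, `u ∈ Ẑ^×` maps the lattice
`Im((O^×)^H) ⊆ O^{×μ}` into itself. [claim: Mochizuki2012, status: disputed] (IUTchII §1 Ex 1.8 (iv), kurims p.39) -/
theorem map_invariantLattice_le (u : ZHatUnits) (H : Subgroup Γ) :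
    (invariantLattice (unitsActionOf C θ) H).map (zhatOxmu C u).toMonoidHom ≤ invariantLattice (unitsActionOf C θ) H := by
  rintro _ ⟨q, hq, rfl⟩
  obtain ⟨x, hx, rfl⟩ := Subgroup.mem_map.mp hq
  rw [mem_fixedBy] at hx
  -- the unit `x` is fixed by `θ(H) ⊆ G_k`
  have hfix : ∀ σ ∈ H.map θ, σ (((unitsBridge C x : unitGroup C.k C.K) : (C.K)ˣ) : C.K) =
      (((unitsBridge C x : unitGroup C.k C.K) : (C.K)ˣ) : C.K) := by
    rintro _ ⟨h, hh, rfl⟩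
    have := congrArg (fun y : (nonzeroIntegers C.k C.K)ˣ => ((y : nonzeroIntegers C.k C.K) : C.K)) (hx h hh)
    simpa using this
  obtain ⟨v, hv, hzp⟩ := C.exists_fixed_zpPow_mk_eq_mk (H.map θ) (unitsBridge C x) hfix
    (ZHatLevel.padicCharUnits C.residueChar u)
  refine Subgroup.mem_map.mpr ⟨(unitsBridge C).symm v, ?_, ?_⟩
  · rw [mem_fixedBy]
    intro h hh
    apply Units.ext; apply Subtype.ext
    rw [coe_unitsActionOf, coe_unitsBridge_symm]
    exact hv (θ h) ⟨h, hh, rfl⟩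
  · change QuotientGroup.mk ((unitsBridge C).symm v) = zhatOxmu C u (QuotientGroup.mk x)
    rw [zhatOxmu_apply, oxmuBridge_mk, hzp, oxmuBridge_symm_mk]

/-- **LATTICE PRESERVATION**: `u ∈ Ẑ^×` carries each lattice `Im((O^×)^H)` ONTO itself (apply the inclusion to `u`
and `u⁻¹`). [claim: Mochizuki2012, status: disputed] (IUTchII §1 Ex 1.8 (iv), kurims p.39) -/
theorem map_invariantLattice_eq (u : ZHatUnits) (H : Subgroup Γ) :
    (invariantLattice (unitsActionOf C θ) H).map (zhatOxmu C u).toMonoidHom = invariantLattice (unitsActionOf C θ) H := by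
  refine le_antisymm (map_invariantLattice_le C θ u H) fun q hq => ?_
  have hq' : zhatOxmu C u⁻¹ q ∈ invariantLattice (unitsActionOf C θ) H :=
    map_invariantLattice_le C θ u⁻¹ H (Subgroup.mem_map.mpr ⟨q, hq, rfl⟩)
  refine Subgroup.mem_map.mpr ⟨zhatOxmu C u⁻¹ q, hq', ?_⟩
  change zhatOxmu C u (zhatOxmu C u⁻¹ q) = q
  rw [← MulAut.mul_apply, ← map_mul, mul_inv_cancel, map_one, MulAut.one_apply]

/-- **Every `u ∈ Ẑ^×` acts by a `G`-ISOMETRY of `O^{×μ}`** — `G`-equivariant and preserving the lattice of every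
subgroup `H` in any prescribed family `𝓗` (print: the open subgroups).
[claim: Mochizuki2012, status: disputed] (IUTchII §1 Ex 1.8 (iv), kurims p.39) -/
theorem zhatOxmu_mem_isometryGroup (𝓗 : Set (Subgroup Γ)) (u : ZHatUnits) :
    zhatOxmu C u ∈ isometryGroup (unitsActionOf C θ) 𝓗 := by
  refine (mem_isometryGroup _ _ _).mpr ⟨fun γ => ?_, fun H _ => map_invariantLattice_eq C θ u H⟩
  ext x
  exact zhatOxmu_actionModTorsion C θ u γ x

end Genuine

/-! ## The fully genuine producer -/

section Producer

open Genuine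

variable (S : ThetaSetting.{0}) (C : MLFClosure.{0}) (ε : S.Gk ≃ₜ* (ModelMLFGaloisData.galois C.k C.K).tmPair.Pi)
  (hΔ : ∀ f : S.PiX ≃ₜ* S.PiX, S.DeltaX.map f.toMulEquiv.toMonoidHom = S.DeltaX)
  (hq : Nonempty (TopGroup.quot S.PiX S.DeltaX ≃ₜ* S.Gk))

/-- The `G`-action on `O^×(G) = (𝒪_k̄^⊳)ˣ` of the genuine producer is the Galois-type action through the chosen
identification `theta`. [claim: Mochizuki2012, status: disputed] (IUTchII §1 Ex 1.8 (iii), kurims p.37) -/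
theorem genuineOfModel_actOunits (G : IsoClass S.Gk) :
    (genuineOfModel S C ε hΔ hq).actOunits G = unitsActionOf C (Genuine.theta C ε G).toMonoidHom := by
  ext g x
  rfl

/-- **The GENUINE `AbsTopMonoids S`** ([IUTchII] Ex. 1.8 (ii)–(iv)): abc-iut-L6-t13's `genuineOfModel` with its
DEGENERATE `Ism`-side replaced by print's isometry group `Ism(G)` (`ism`), its tautological action, and
`Ẑ^× ↠ ℤ_p^× ↪ Ism(G)` (`zhatOxmu`, by isometries: `zhatOxmu_mem_isometryGroup`).
[claim: Mochizuki2012, status: disputed] (IUTchII §1 Ex 1.8 (ii)-(iv), kurims pp.36-39) -/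
def genuineOfModelIsm : AbsTopMonoids S :=
  haveI := C.fact_residueChar_prime
  (genuineOfModel S C ε hΔ hq).withIsometries (fun _ => zhatOxmu C) fun G u => by
    change zhatOxmu C u ∈ isometryGroup ((genuineOfModel S C ε hΔ hq).actOunits G) (openSubgroups G)
    rw [genuineOfModel_actOunits]
    exact zhatOxmu_mem_isometryGroup C _ _ u

/-- `O^⊳(G) = 𝒪_k̄^⊳` (definitionally, as for `genuineOfModel`). [claim: Mochizuki2012, status: disputed] (IUTchII §1 Ex 1.8 (ii), kurims p.36) -/
@[simp] theorem genuineOfModelIsm_Otri (G : IsoClass S.Gk) :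
    (genuineOfModelIsm S C ε hΔ hq).Otri G = (ModelMLFGaloisData.galois C.k C.K).tmPair.M := rfl

/-- The `G`-actions on `O^⊳(G)` are those of `genuineOfModel`. [claim: Mochizuki2012, status: disputed] (IUTchII §1 Ex 1.8 (ii), kurims p.36) -/
theorem genuineOfModelIsm_actOtri : (genuineOfModelIsm S C ε hΔ hq).actOtri = (genuineOfModel S C ε hΔ hq).actOtri := rfl

/-- The transports `O^⊳(f)` are those of `genuineOfModel` (THE lifts `liftM`). [claim: Mochizuki2012, status: disputed] (IUTchII §1 Ex 1.8 (iii), kurims p.38) -/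
theorem genuineOfModelIsm_mapOtri {G H : IsoClass S.Gk} (f : G ⟶ H) :
    (genuineOfModelIsm S C ε hΔ hq).mapOtri f = (genuineOfModel S C ε hΔ hq).mapOtri f := rfl

/-- `M_TM(Π)` is that of `genuineOfModel`. [claim: Mochizuki2012, status: disputed] (IUTchII §1 Ex 1.8 (ii), kurims p.36) -/
theorem genuineOfModelIsm_MTM : (genuineOfModelIsm S C ε hΔ hq).MTM = (genuineOfModel S C ε hΔ hq).MTM := rfl

/-- **`Ism(G)` of the genuine producer IS print's isometry group** of `G ↷ O^{×μ}(G)` w.r.t. the open subgroups.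
[claim: Mochizuki2012, status: disputed] (IUTchII §1 Ex 1.8 (iv), kurims p.39) -/
theorem genuineOfModelIsm_Ism (G : IsoClass S.Gk) :
    (genuineOfModelIsm S C ε hΔ hq).Ism G = ↥((genuineOfModel S C ε hΔ hq).ism G) := rfl

/-- The action of `Ẑ^×` through `Ism(G)` on `O^{×μ}(G)` is `zhatOxmu`. [claim: Mochizuki2012, status: disputed] (IUTchII §1 Ex 1.8 (iv), kurims p.39) -/
theorem genuineOfModelIsm_actIsm_toIsm (G : IsoClass S.Gk) (u : ZHatUnits) :
    (genuineOfModelIsm S C ε hΔ hq).actIsm G ((genuineOfModelIsm S C ε hΔ hq).toIsm G u) =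
      haveI := C.fact_residueChar_prime; zhatOxmu C u := rfl

/-- **`u ∈ Ẑ^×` acts on `O^{×μ}(G)` as `x ↦ x^{χ_p(u)}`**: `log_k̄ (u · x) = χ_p(u) · log_k̄ x`.
[claim: Mochizuki2012, status: disputed] (IUTchII §1 Ex 1.8 (iv), kurims p.39) -/
theorem toAdd_log_actIsm_toIsm (G : IsoClass S.Gk) (u : ZHatUnits) (x : (genuineOfModelIsm S C ε hΔ hq).Oxmu G) :
    haveI := C.fact_residueChar_prime
    Multiplicative.toAdd (C.logEquiv (oxmuBridge C
        ((genuineOfModelIsm S C ε hΔ hq).actIsm G ((genuineOfModelIsm S C ε hΔ hq).toIsm G u) x))) =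
      C.padicScalar (ZHatLevel.padicChar C.residueChar u) * Multiplicative.toAdd (C.logEquiv (oxmuBridge C x)) :=
  haveI := C.fact_residueChar_prime
  toAdd_log_zhatOxmu C u x

end Producer

end AbsTopMonoids

end Literature.IUT.HodgeArakelov

end
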